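import Summits.Ventures.YMGap.RobustBall.BoundaryDecayBall
import Summits.Ventures.YMGap.RobustBall.PeriodisedBox
import HarnessLib

/-!
# Venture YMGap, track ROBUST-BALL — ONE STATE AT A RATE, step 3: the thermodynamic limit along centred boxes is
# reached EXPONENTIALLY FAST in the box size, uniformly in the boundary field

HONEST FRAMING. WHAT THIS IS: a venture file (cell `pub-ymgap`, track Y2 ROBUST-BALL, seat ds-3, theorems only): the
box reading of `BoundaryDecay.lean` / `BoundaryDecayBall.lean`. For an observable living on the links based in the
centred box `[−m, m]^d` (`boxLinks d m`, `PeriodisedBox.lean`) and the finite-volume Gibbs distribution in the box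
`[−n, n]^d` with ANY boundary field `η`, the links outside `boxLinks d n` are at base-point `ℓ^∞`-distance `> n − m`
from the observable (`sub_le_norm_sub_of_mem_boxLinks`), so:
* `abs_box_sub_integral_le_of_isKRContraction` — ANY robust single-link door (row sums `≤ ρ < 1`, range `R`): for every
  DLR state `μ`, every `n`, every `η`, every Lipschitz cylinder `F` (constant `K`, links `Δ ⊆ boxLinks d m`):
  `|∫ F dγ^W_{box n}(· | η) − ∫ F dμ| ≤ 2√N · K · #Δ · max(ρ,½)^{⌊(n − m)/max(1,R)⌋₊}` — the thermodynamic limit of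
  `OneStateBoundary.lean` (`boundaryLimit_*`, no rate) is attained at an EXPONENTIAL RATE in `n`, UNIFORMLY IN `η`;
  two boundary fields: `abs_box_sub_box_le_of_isKRContraction`;
* `SU(2)`, `d = 4`, hypothesis-free on the ball (`su2_abs_box_sub_integral_le_dim4`): `6|β_W| e^{ε₀} + e^{ε₀/2} √(2/3) ε₁ ≤ ρ < 1`
  ⇒ `2√2 · K · #Δ · max(ρ,½)^{⌊(n − m)/max(1,R)⌋₊}` for every member of `MemBallZd ε₀ ε₁ R`;
* THE WILSON POINT (`su2_wilson_box_upTo_oneTwelfth`): for `0 ≤ β_W ≤ 1/12`, every DLR state `μ` of `SU(2)` lattice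
  Yang–Mills on `ℤ⁴`, every `n ≥ m` and every boundary field: `|∫ F dγ_{box n}(· | η) − ∫ F dμ| ≤ 2√2 · K · #Δ · 2^{−(n−m)}`
  — each extra lattice layer between the observable and the boundary halves the boundary's influence;
  `1/12 ≤ β_W < 1/6`: `(6β_W)^{n−m}` (`su2_wilson_box_lt_oneSixth`).
WHAT THIS IS NOT: Dobrushin-comparison lower bound on the rate, single-link doors; lattice strong coupling only, nothing
about the continuum limit or the Clay Millennium problem.

References: H.-O. Georgii (2011), Remark 8.26, Prop. 7.11; H. Föllmer, LNM 1362 (1988), Ch. I, (2.8), (2.10); the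
track's `BoundaryDecay.lean`, `BoundaryDecayBall.lean`, `PeriodisedBox.lean`, `OneStateBoundary.lean`.
-/

noncomputable section

open MeasureTheory Filter Function ProbabilityTheory Real
open scoped NNReal
open Literature.Probability.LatticeModels
open Literature.Probability.LatticeModels.DobrushinMetric
open Literature.MathematicalPhysics.QuantumLattice
open Literature.MathematicalPhysics.QuantumFieldTheory hiding ZdEdge

namespace Summit.Ventures.YMGap.RobustBall

variable {d N : ℕ}

/-! ### Geometry: boxes -/

/-- **Links outside the big box are far from links in the small box**: for `y ∈ boxLinks d m` and `z ∉ boxLinks d n`,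
`n − m ≤ ‖y.1 − z.1‖_∞` (in fact `<`). [folklore] -/
theorem sub_le_norm_sub_of_mem_boxLinks {m n : ℕ} {y z : ZdEdge d} (hy : y ∈ boxLinks d m) (hz : z ∉ boxLinks d n) :
    (n : ℝ) - m ≤ ‖y.1 - z.1‖ := by
  rw [mem_boxLinks, mem_siteBox_iff_norm] at hy hz
  have hz' : (n : ℝ) < ‖z.1‖ := lt_of_not_ge hz
  have h := norm_sub_norm_le z.1 y.1
  rw [norm_sub_rev] at h
  linarith

/-- `⌊(n : ℝ) − m⌋₊ = n − m` (truncated subtraction). [folklore] -/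
theorem natFloor_natCast_sub_natCast (n m : ℕ) : ⌊(n : ℝ) - m⌋₊ = n - m := by
  rcases le_or_gt m n with h | h
  · rw [← Nat.cast_sub h, Nat.floor_natCast]
  · rw [Nat.floor_of_nonpos (by linarith [(Nat.cast_lt (α := ℝ)).2 h]), eq_comm]
    exact Nat.sub_eq_zero_of_le h.le

/-! ### Any robust single-link door: the thermodynamic limit along boxes at an exponential rate, uniformly in `η` -/

/-- **THERMODYNAMIC LIMIT AT AN EXPONENTIAL RATE, UNIFORMLY IN THE BOUNDARY FIELD, from ANY robust single-link door.**
Under an `IsKRContraction (perturbedYM (fundamentalRep (Fin N)) (N β) W supp) suFrobDist (perturbedNbr supp) C` with row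
sums `≤ ρ < 1` and range `R`: for every DLR state `μ`, every `m ≤ n`-free pair of box sizes, every boundary field `η` and
every Lipschitz cylinder `F` (constant `K`) on links `Δ ⊆ boxLinks d m`:
`|∫ F dγ^W_{boxLinks d n}(· | η) − ∫ F dμ| ≤ 2√N · K · #Δ · max(ρ,½)^{⌊(n − m)/max(1,R)⌋₊}`. [folklore] -/
theorem abs_box_sub_integral_le_of_isKRContraction {β ρ R : ℝ}
    {W : Potential (ZdEdge d) (Matrix.specialUnitaryGroup (Fin N) ℂ)} (hW : W.IsAdapted)
    (hWb : ∀ X, ∃ C, ∀ U, |W X U| ≤ C)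
    {supp : Finset (ZdEdge d) → Finset (Finset (ZdEdge d))} (hsupp : W.IsSupportedBy supp)
    {C : ZdEdge d → ZdEdge d → ℝ}
    (hKR : IsKRContraction (perturbedYM (d := d) (fundamentalRep (Fin N)) (N * β) W supp) suFrobDist
      (perturbedNbr supp) C)
    (hrow : ∀ x, ∑ y ∈ perturbedNbr supp x, C x y ≤ ρ) (hρ : ρ < 1)
    (hR : ∀ e, ∀ X ∈ supp {e}, e ∈ X → ∀ y ∈ X, ‖e.1 - y.1‖ ≤ R)
    {μ : Measure (LGConfig d (Matrix.specialUnitaryGroup (Fin N) ℂ))}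
    (hμ : μ ∈ perturbedGibbsMeasures (d := d) (fundamentalRep (Fin N)) (N * β) W supp) {m : ℕ} (n : ℕ)
    (η : LGConfig d (Matrix.specialUnitaryGroup (Fin N) ℂ))
    {F : LGConfig d (Matrix.specialUnitaryGroup (Fin N) ℂ) → ℝ} {Δ : Finset (ZdEdge d)} {K : ℝ≥0}
    (hF : IsLipschitzCylinder (fundamentalRep (Fin N)) F Δ K) (hΔ : Δ ⊆ boxLinks d m) :
    |(∫ U, F U ∂(perturbedYM (d := d) (fundamentalRep (Fin N)) (N * β) W supp (boxLinks d n) η)) - ∫ U, F U ∂μ| ≤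
      2 * Real.sqrt N * K * Δ.card * (max ρ (1 / 2)) ^ ⌊((n : ℝ) - m) / max 1 R⌋₊ :=
  abs_boundary_sub_integral_le_of_isKRContraction hW hWb hsupp hKR hrow hρ hR hμ (boxLinks d n) η hF
    fun _ hy _ hz => sub_le_norm_sub_of_mem_boxLinks (hΔ hy) hz

/-- **Two boundary fields on the same box, from ANY robust single-link door** (no DLR state needed):
`|∫ F dγ^W_{box n}(· | η) − ∫ F dγ^W_{box n}(· | η')| ≤ 2√N · K · #Δ · max(ρ,½)^{⌊(n − m)/max(1,R)⌋₊}`. [folklore] -/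
theorem abs_box_sub_box_le_of_isKRContraction {β ρ R : ℝ}
    {W : Potential (ZdEdge d) (Matrix.specialUnitaryGroup (Fin N) ℂ)} (hW : W.IsAdapted)
    (hWb : ∀ X, ∃ C, ∀ U, |W X U| ≤ C)
    {supp : Finset (ZdEdge d) → Finset (Finset (ZdEdge d))} (hsupp : W.IsSupportedBy supp)
    {C : ZdEdge d → ZdEdge d → ℝ}
    (hKR : IsKRContraction (perturbedYM (d := d) (fundamentalRep (Fin N)) (N * β) W supp) suFrobDist
      (perturbedNbr supp) C)
    (hrow : ∀ x, ∑ y ∈ perturbedNbr supp x, C x y ≤ ρ) (hρ : ρ < 1)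
    (hR : ∀ e, ∀ X ∈ supp {e}, e ∈ X → ∀ y ∈ X, ‖e.1 - y.1‖ ≤ R) {m : ℕ} (n : ℕ)
    (η η' : LGConfig d (Matrix.specialUnitaryGroup (Fin N) ℂ))
    {F : LGConfig d (Matrix.specialUnitaryGroup (Fin N) ℂ) → ℝ} {Δ : Finset (ZdEdge d)} {K : ℝ≥0}
    (hF : IsLipschitzCylinder (fundamentalRep (Fin N)) F Δ K) (hΔ : Δ ⊆ boxLinks d m) :
    |(∫ U, F U ∂(perturbedYM (d := d) (fundamentalRep (Fin N)) (N * β) W supp (boxLinks d n) η)) -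
        ∫ U, F U ∂(perturbedYM (d := d) (fundamentalRep (Fin N)) (N * β) W supp (boxLinks d n) η')| ≤
      2 * Real.sqrt N * K * Δ.card * (max ρ (1 / 2)) ^ ⌊((n : ℝ) - m) / max 1 R⌋₊ :=
  abs_boundary_sub_boundary_le_of_isKRContraction hW hWb hsupp hKR hrow hρ hR (boxLinks d n) η η' hF
    fun _ hy _ hz => sub_le_norm_sub_of_mem_boxLinks (hΔ hy) hz

/-! ### `SU(2)`, `d = 4`: the ball and the Wilson point -/

/-- **`SU(2)`, `d = 4`, HYPOTHESIS-FREE, UNIFORMLY ON THE BALL**: `6|β_W| e^{ε₀} + e^{ε₀/2} √(2/3) ε₁ ≤ ρ < 1` ⇒ for every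
member of `MemBallZd ε₀ ε₁ R`, every DLR state, every pair of box sizes, every boundary field and every Lipschitz cylinder
on `boxLinks 4 m`: `|∫ F dγ^W_{box n}(· | η) − ∫ F dμ| ≤ 2√2 · K · #Δ · max(ρ,½)^{⌊(n − m)/max(1,R)⌋₊}`. [folklore] -/
theorem su2_abs_box_sub_integral_le_dim4 {βW ε₀ ε₁ ρ R : ℝ}
    (hρ : 6 * |βW| * exp ε₀ + exp (ε₀ / 2) * Real.sqrt (2 / 3) * ε₁ ≤ ρ) (hρ1 : ρ < 1)
    {W : Potential (ZdEdge 4) (Matrix.specialUnitaryGroup (Fin 2) ℂ)}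
    {supp : Finset (ZdEdge 4) → Finset (Finset (ZdEdge 4))} (hmem : MemBallZd ε₀ ε₁ R W supp)
    {μ : Measure (LGConfig 4 (Matrix.specialUnitaryGroup (Fin 2) ℂ))}
    (hμ : μ ∈ perturbedGibbsMeasures (d := 4) (fundamentalRep (Fin 2)) ((2 : ℕ) * (βW / 4)) W supp) {m : ℕ} (n : ℕ)
    (η : LGConfig 4 (Matrix.specialUnitaryGroup (Fin 2) ℂ))
    {F : LGConfig 4 (Matrix.specialUnitaryGroup (Fin 2) ℂ) → ℝ} {Δ : Finset (ZdEdge 4)} {K : ℝ≥0}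
    (hF : IsLipschitzCylinder (fundamentalRep (Fin 2)) F Δ K) (hΔ : Δ ⊆ boxLinks 4 m) :
    |(∫ U, F U ∂(perturbedYM (d := 4) (fundamentalRep (Fin 2)) ((2 : ℕ) * (βW / 4)) W supp (boxLinks 4 n) η)) -
        ∫ U, F U ∂μ| ≤ 2 * Real.sqrt 2 * K * Δ.card * (max ρ (1 / 2)) ^ ⌊((n : ℝ) - m) / max 1 R⌋₊ :=
  su2_abs_boundary_sub_integral_le_dim4 hρ hρ1 hmem hμ (boxLinks 4 n) η hF
    fun _ hy _ hz => sub_le_norm_sub_of_mem_boxLinks (hΔ hy) hz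

/-- **THE WILSON POINT, BOXES**: for `0 ≤ β_W ≤ 1/12`, every DLR state `μ` of `SU(2)` lattice Yang–Mills on `ℤ⁴` (tree
coupling `β_W/2`), every pair of box sizes `m, n`, EVERY boundary field `η` and every Lipschitz cylinder `F` (constant
`K`) on the links based in `[−m, m]⁴`:
`|∫ F dγ_{boxLinks 4 n}(· | η) − ∫ F dμ| ≤ 2√2 · K · #Δ · (1/2)^{n − m}` — every extra layer of lattice between the
observable and the boundary halves the influence of the boundary field. [folklore] -/
theorem su2_wilson_box_upTo_oneTwelfth {βW : ℝ} (h0 : 0 ≤ βW) (h : βW ≤ 1 / 12)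
    {μ : Measure (LGConfig 4 (Matrix.specialUnitaryGroup (Fin 2) ℂ))}
    (hμ : μ ∈ ymGibbsMeasures (d := 4) (fundamentalRep (Fin 2)) (βW / 2)) {m : ℕ} (n : ℕ)
    (η : LGConfig 4 (Matrix.specialUnitaryGroup (Fin 2) ℂ))
    {F : LGConfig 4 (Matrix.specialUnitaryGroup (Fin 2) ℂ) → ℝ} {Δ : Finset (ZdEdge 4)} {K : ℝ≥0}
    (hF : IsLipschitzCylinder (fundamentalRep (Fin 2)) F Δ K) (hΔ : Δ ⊆ boxLinks 4 m) :
    |(∫ U, F U ∂(ymSpecification (d := 4) (fundamentalRep (Fin 2)) (βW / 2) (boxLinks 4 n) η)) - ∫ U, F U ∂μ| ≤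
      2 * Real.sqrt 2 * K * Δ.card * (1 / 2 : ℝ) ^ (n - m) := by
  have key := su2_wilson_boundary_upTo_oneTwelfth h0 h hμ (boxLinks 4 n) η hF (D := (n : ℝ) - m)
    fun _ hy _ hz => sub_le_norm_sub_of_mem_boxLinks (hΔ hy) hz
  rwa [natFloor_natCast_sub_natCast] at key

/-- The same for `1/12 ≤ β_W < 1/6`: `|∫ F dγ_{boxLinks 4 n}(· | η) − ∫ F dμ| ≤ 2√2 · K · #Δ · (6β_W)^{n − m}`. [folklore] -/
theorem su2_wilson_box_lt_oneSixth {βW : ℝ} (h0 : 1 / 12 ≤ βW) (h : βW < 1 / 6)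
    {μ : Measure (LGConfig 4 (Matrix.specialUnitaryGroup (Fin 2) ℂ))}
    (hμ : μ ∈ ymGibbsMeasures (d := 4) (fundamentalRep (Fin 2)) (βW / 2)) {m : ℕ} (n : ℕ)
    (η : LGConfig 4 (Matrix.specialUnitaryGroup (Fin 2) ℂ))
    {F : LGConfig 4 (Matrix.specialUnitaryGroup (Fin 2) ℂ) → ℝ} {Δ : Finset (ZdEdge 4)} {K : ℝ≥0}
    (hF : IsLipschitzCylinder (fundamentalRep (Fin 2)) F Δ K) (hΔ : Δ ⊆ boxLinks 4 m) :
    |(∫ U, F U ∂(ymSpecification (d := 4) (fundamentalRep (Fin 2)) (βW / 2) (boxLinks 4 n) η)) - ∫ U, F U ∂μ| ≤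
      2 * Real.sqrt 2 * K * Δ.card * (6 * βW) ^ (n - m) := by
  have key := su2_wilson_boundary_lt_oneSixth h0 h hμ (boxLinks 4 n) η hF (D := (n : ℝ) - m)
    fun _ hy _ hz => sub_le_norm_sub_of_mem_boxLinks (hΔ hy) hz
  rwa [natFloor_natCast_sub_natCast] at key

/-- **Two boundary fields at the Wilson point**: for `0 ≤ β_W ≤ 1/12`, any two finite-volume `SU(2)` Wilson distributions
in the box `[−n, n]⁴` with boundary fields `η, η'` agree on Lipschitz cylinders based in `[−m, m]⁴` up to
`2√2 · K · #Δ · (1/2)^{n − m}`. [folklore] -/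
theorem su2_wilson_box_sub_box_upTo_oneTwelfth {βW : ℝ} (h0 : 0 ≤ βW) (h : βW ≤ 1 / 12) {m : ℕ} (n : ℕ)
    (η η' : LGConfig 4 (Matrix.specialUnitaryGroup (Fin 2) ℂ))
    {F : LGConfig 4 (Matrix.specialUnitaryGroup (Fin 2) ℂ) → ℝ} {Δ : Finset (ZdEdge 4)} {K : ℝ≥0}
    (hF : IsLipschitzCylinder (fundamentalRep (Fin 2)) F Δ K) (hΔ : Δ ⊆ boxLinks 4 m) :
    |(∫ U, F U ∂(ymSpecification (d := 4) (fundamentalRep (Fin 2)) (βW / 2) (boxLinks 4 n) η)) -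
        ∫ U, F U ∂(ymSpecification (d := 4) (fundamentalRep (Fin 2)) (βW / 2) (boxLinks 4 n) η')| ≤
      2 * (2 * Real.sqrt 2 * K * Δ.card * (1 / 2 : ℝ) ^ (n - m)) := by
  -- through the (unique) DLR state: existence from the tree (`ymGibbsMeasures` is nonempty at every coupling)
  obtain ⟨μ, hμ⟩ := ymGibbsMeasures_nonempty (d := 4) (fundamentalRep (Fin 2)) (continuous_fundamentalRep (Fin 2))
    (βW / 2)
  have h1 := su2_wilson_box_upTo_oneTwelfth h0 h hμ n η hF hΔ
  have h2 := su2_wilson_box_upTo_oneTwelfth h0 h hμ n η' hF hΔ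
  rw [abs_sub_comm] at h2
  calc |(∫ U, F U ∂(ymSpecification (d := 4) (fundamentalRep (Fin 2)) (βW / 2) (boxLinks 4 n) η)) -
          ∫ U, F U ∂(ymSpecification (d := 4) (fundamentalRep (Fin 2)) (βW / 2) (boxLinks 4 n) η')|
      ≤ |(∫ U, F U ∂(ymSpecification (d := 4) (fundamentalRep (Fin 2)) (βW / 2) (boxLinks 4 n) η)) - ∫ U, F U ∂μ| +
          |(∫ U, F U ∂μ) - ∫ U, F U ∂(ymSpecification (d := 4) (fundamentalRep (Fin 2)) (βW / 2) (boxLinks 4 n) η')| :=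
        abs_sub_le _ _ _
    _ ≤ _ := by linarith

end Summit.Ventures.YMGap.RobustBall

end
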